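import Summits.QuantumFields.GaugeBoot.TiltedBoxOddMidAxisRPTwoDimPrep
import Summits.QuantumFields.GaugeBoot.SlabKernelTwoLayer
import Summits.QuantumFields.GaugeBoot.TiltedBoxEvenMidAxisRPTwoDim
import HarnessLib

/-!
# Reduced-half link RP on the odd square tilted box in two dimensions: integrating the three annuli and the free layer (gauge-boot, L3 supplement: 2D slab gluing, reduced-half link mirror 4a/4)

HONEST FRAMING (cell `pub-gaugeboot`, page 1 of every file): the venture produces certified bounds
on lattice expectations at stated coupling, gauge group, dimension and torus size; NOT a mass gap,
NOT a continuum limit, NOT a string tension; NOT Yang–Mills-summit-bearing (barriers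
`FixedCouplingUltralocality`, `PerturbativeInvisibility`). Measure-theoretic bookkeeping for the POSITIVE
two-dimensional result `TiltedBoxOddMidAxisRPTwoDim.lean`; it discharges nothing else.

Odd square box `ℤ^d/Γ(2P+1, 2P+1, L)`, two dimensions, link mirror `Θ_mid : x_i ↦ 1 - x_i`, reduced half
`{1 ≤ x_i ≤ P}`. After the split of the Boltzmann weight (`boltzmann_split_red`) the integrand is
`h · ∏_{P|P+1} · ∏_{P+1|P+2} · ∏_{0|1}` with three annulus products of one-plaquette weights.

* the layer words `wLoR` (layer `1`), `wUpR` (layer `P`), `wMidR` (the FREE layer `P + 1`), `wTopR`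
  (layer `P + 2`) and `psiR = ω_β^{⋆(2P+1)}`;
* **`integral_hRed_annuli`** — Migdal's recursion integrates the rungs of the three annuli
  (`SlabKernel.integral_mul_annulus`, thrice: the annuli are pairwise disjoint and `h` does not see their
  rungs), leaving `k_ψ(w₀, w₁) · k_ψ(w_P, w_{P+1}) · k_ψ(w_{P+1}, w_{P+2})`; integrating ONE letter of the free
  word (`wMidR_update`: `w_{P+1}(U[ℓ₀ ↦ z]) = z · V(U)`, Haar distributed) composes the two upper kernels
  into the two-layer kernel `K_ψ(w_P, w_{P+2})` (`SlabKernel.integral_slabKernel_mul_slabKernel`); finally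
  the lower annulus is exact (`w₁ ∘ Θ = w₀`, symmetry of `k_ψ`) and `w_{P+2}` is a conjugate of `w_P ∘ Θ`
  (`oprod_upAt_succ_eq_conj`, class invariance of `K_ψ`):
  `∫ h · ∏ · ∏ · ∏ dμ₀ = ∫ h · k_ψ(w₁, w₁∘Θ) · K_ψ(w_P, w_P∘Θ) dμ₀`.

All `[folklore]` (Fubini on the product Haar measure; Migdal 1975, Osterwalder–Seiler 1978 §2).
References: A. A. Migdal, Sov. Phys. JETP 42 (1975) 413; K. Osterwalder, E. Seiler, Ann. Phys. 110
(1978) 440, §2; B. K. Driver, Commun. Math. Phys. 123 (1989) 575, §7.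
-/

noncomputable section

open MeasureTheory Complex Function
open scoped ComplexOrder ComplexConjugate
open Literature.MathematicalPhysics.QuantumFieldTheory (haarProbability)
open Literature.MathematicalPhysics.QuantumFieldTheory.LatticeRP (piMeasure splice splice_eq_piecewise
  integral_splice_mul_conj_comp_of_shared_nonneg)
open Literature.RepresentationTheory.CompactGroups

namespace Summit.QuantumFields.GaugeBoot

namespace TiltedRP

namespace TwoDim

variable {d : ℕ} {i j : Fin d} {L P N : ℕ} [NeZero L] [NeZero P]
variable {G : Type*} [Group G] [TopologicalSpace G] [IsTopologicalGroup G] [CompactSpace G]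
  [MeasurableSpace G] [BorelSpace G] [SecondCountableTopology G]
variable (ρ : G →* Matrix (Fin N) (Fin N) ℂ)

/-! ## The words of the layers `1`, `P`, `P + 1`, `P + 2` and the kernel weight -/

/-- The word of the layer `1` (upper letters of the lower annulus): `w₁(U) = ∏_{t<2M} U(t e_j + e_i, j)`. -/
def wLoR (U : Config (TiltedSite d i j (2 * P + 1) (2 * P + 1) L) d G) : G :=
  SlabKernel.oprod (upAt (0 : TiltedSite d i j (2 * P + 1) (2 * P + 1) L)) (2 * (2 * P + 1)) U

/-- The word of the layer `P` (lower letters of the annulus `P|P+1`): `w_P(U) = ∏_{t<2M} U(y₀ + t e_j, j)`. -/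
def wUpR (U : Config (TiltedSite d i j (2 * P + 1) (2 * P + 1) L) d G) : G :=
  SlabKernel.oprod (loAt (oddLayerSite d i j L P)) (2 * (2 * P + 1)) U

/-- The word of the FREE layer `P + 1`: `w_{P+1}(U) = ∏_{t<2M} U(y₀ + t e_j + e_i, j)`. -/
def wMidR (U : Config (TiltedSite d i j (2 * P + 1) (2 * P + 1) L) d G) : G :=
  SlabKernel.oprod (upAt (oddLayerSite d i j L P)) (2 * (2 * P + 1)) U

/-- The word of the layer `P + 2` (upper letters of the annulus `P+1|P+2`). -/
def wTopR (U : Config (TiltedSite d i j (2 * P + 1) (2 * P + 1) L) d G) : G :=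
  SlabKernel.oprod (upAt (oddLayerSite d i j L P + tiltedUnit d i j (2 * P + 1) (2 * P + 1) L i)) (2 * (2 * P + 1)) U

variable (P) in
/-- The convolution power `ψ = ω_β^{⋆(2P+1)}` of the one-plaquette weight. -/
def psiR (β : ℝ) : G → ℝ := SlabKernel.convPow (SlabKernel.wilsonWt ρ β) (2 * P + 1)

omit [NeZero L] [NeZero P] [CompactSpace G] [MeasurableSpace G] [BorelSpace G] [SecondCountableTopology G] in
/-- The layer words are continuous. [folklore] -/
theorem continuous_wordsR :
    Continuous (wLoR (L := L) (P := P) (i := i) (j := j) (d := d) (G := G)) ∧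
    Continuous (wUpR (L := L) (P := P) (i := i) (j := j) (d := d) (G := G)) ∧
    Continuous (wMidR (L := L) (P := P) (i := i) (j := j) (d := d) (G := G)) ∧
    Continuous (wTopR (L := L) (P := P) (i := i) (j := j) (d := d) (G := G)) :=
  ⟨SlabKernel.continuous_oprod (fun _ => continuous_apply _) _, SlabKernel.continuous_oprod (fun _ => continuous_apply _) _,
    SlabKernel.continuous_oprod (fun _ => continuous_apply _) _, SlabKernel.continuous_oprod (fun _ => continuous_apply _) _⟩

omit [NeZero L] [NeZero P] [TopologicalSpace G] [IsTopologicalGroup G] [CompactSpace G] [MeasurableSpace G] [BorelSpace G]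
  [SecondCountableTopology G] in
/-- The lower word of the annulus `P+1|P+2` is the free word. [folklore] -/
theorem oprod_loAt_oddLayerSite_add (n : ℕ) (U : Config (TiltedSite d i j (2 * P + 1) (2 * P + 1) L) d G) :
    SlabKernel.oprod (loAt (oddLayerSite d i j L P + tiltedUnit d i j (2 * P + 1) (2 * P + 1) L i)) n U =
      SlabKernel.oprod (upAt (oddLayerSite d i j L P)) n U := by
  unfold SlabKernel.oprod
  congr 1
  exact List.map_congr_left fun t _ => loAt_oddLayerSite_add t U

/-! ## The three annuli are pairwise disjoint; the free letter -/

omit [NeZero L] [NeZero P] in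
/-- Rungs through base sites of different layers are distinct. [folklore] -/
theorem rungAt_ne_of_val_ne (hij : i ≠ j) {y y' : TiltedSite d i j (2 * P + 1) (2 * P + 1) L}
    (h : (axisCoord d L (2 * P + 1) y).val ≠ (axisCoord d L (2 * P + 1) y').val) (t s : ℕ) :
    rungAt y t ≠ rungAt y' s := by
  intro he
  have h1 := congrArg (fun l => (axisCoord d L (2 * P + 1) l.1).val) he
  simp only [rungAt, axisCoord_cyc hij] at h1
  exact h h1

omit [NeZero L] in
/-- `x_i(0) = 0`, `x_i(y₀) = P`, `x_i(y₀ + e_i) = P + 1` are pairwise distinct values. [folklore] -/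
theorem val_layers :
    (axisCoord d L (2 * P + 1) (0 : TiltedSite d i j (2 * P + 1) (2 * P + 1) L)).val = 0 ∧
    (axisCoord d L (2 * P + 1) (oddLayerSite d i j L P)).val = P ∧
    (axisCoord d L (2 * P + 1) (oddLayerSite d i j L P + tiltedUnit d i j (2 * P + 1) (2 * P + 1) L i)).val = P + 1 := by
  refine ⟨by rw [map_zero, ZMod.val_zero], val_axisCoord_oddLayerSite, val_axisCoord_oddLayerSite_add⟩

omit [NeZero L] in
/-- The letters above the free layer are not letters of the free layer: `x_i(x + e_i) ≠ x_i(x)`. [folklore] -/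
theorem axisCoord_add_self_ne (x : TiltedSite d i j (2 * P + 1) (2 * P + 1) L) :
    axisCoord d L (2 * P + 1) (x + tiltedUnit d i j (2 * P + 1) (2 * P + 1) L i) ≠ axisCoord d L (2 * P + 1) x := by
  rw [axisCoord_add_tiltedUnit, if_pos rfl]
  intro h
  have h1 : (1 : ZMod (2 * P + 1)) = 0 := by simpa using h
  have hM1 : 2 * P + 1 ≠ 1 := by have := NeZero.ne P; omega
  have h2 := congrArg ZMod.val h1
  rw [ZMod.val_one'' hM1, ZMod.val_zero] at h2
  exact one_ne_zero h2

omit [NeZero L] [NeZero P] [TopologicalSpace G] [IsTopologicalGroup G] [CompactSpace G] [MeasurableSpace G] [BorelSpace G]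
  [SecondCountableTopology G] in
/-- **The free word with its first letter updated**: `w_{P+1}(U[ℓ₀ ↦ z]) = z · V(U)` with
`ℓ₀ = (y₀ + e_i, j)` and `V` the product of the remaining letters, which does not see `ℓ₀`. [folklore] -/
theorem wMidR_update [DecidableEq (TiltedSite d i j (2 * P + 1) (2 * P + 1) L)] (hij : i ≠ j)
    (U : Config (TiltedSite d i j (2 * P + 1) (2 * P + 1) L) d G) (z : G) :
    wMidR (update U (oddLayerSite d i j L P + tiltedUnit d i j (2 * P + 1) (2 * P + 1) L i, j) z) =
      1 * z * SlabKernel.oprod (fun t => upAt (oddLayerSite d i j L P) (1 + t)) (2 * (2 * P + 1) - 1) U := by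
  unfold wMidR
  rw [show 2 * (2 * P + 1) = 1 + (2 * (2 * P + 1) - 1) by omega, SlabKernel.oprod_add, SlabKernel.oprod_one,
    show 1 + (2 * (2 * P + 1) - 1) - 1 = 2 * (2 * P + 1) - 1 by omega, one_mul]
  congr 1
  · unfold upAt
    rw [cyc_zero, update_self]
  · unfold SlabKernel.oprod
    congr 1
    refine List.map_congr_left fun t ht => ?_
    rw [List.mem_range] at ht
    show upAt (oddLayerSite d i j L P) (1 + t) (update U (oddLayerSite d i j L P + tiltedUnit d i j (2 * P + 1) (2 * P + 1) L i, j) z) =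
      upAt (oddLayerSite d i j L P) (1 + t) U
    unfold upAt
    rw [update_of_ne]
    intro he
    have h1 : cyc (oddLayerSite d i j L P) (1 + t) = cyc (oddLayerSite d i j L P) 0 := by
      rw [cyc_zero]; exact add_right_cancel (congrArg Prod.fst he)
    have := cyc_inj hij _ (by omega) (by omega) h1
    omega

/-! ## Integrating the rungs of the three annuli and the free letter -/

/-- **Three annuli integrated, the free layer composed, both twists removed**:
`∫ h · ∏_{P|P+1} · ∏_{P+1|P+2} · ∏_{0|1} dμ₀ = ∫ h · k_ψ(w₁, w₁∘Θ) · K_ψ(w_P, w_P∘Θ) dμ₀`. [folklore] -/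
theorem integral_hRed_annuli [DecidableEq (TiltedSite d i j (2 * P + 1) (2 * P + 1) L)] (hij : i ≠ j)
    (hd : ∀ k : Fin d, k = i ∨ k = j) (hρ : Continuous ρ) (β : ℝ)
    {F : Config (TiltedSite d i j (2 * P + 1) (2 * P + 1) L) d G → ℂ} (hFm : Measurable F) {CF : ℝ} (hFb : ∀ U, ‖F U‖ ≤ CF)
    (hFo : ∀ U V : Config (TiltedSite d i j (2 * P + 1) (2 * P + 1) L) d G, (∀ l, IsRedLink l → U l = V l) → F U = F V) :
    ∫ U, hRed ρ β F hij U *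
        (∏ t ∈ Finset.range (2 * (2 * P + 1)), SlabKernel.plaqWt (SlabKernel.wilsonWt ρ β)
            (rungAt (oddLayerSite d i j L P)) (loAt (oddLayerSite d i j L P)) (upAt (oddLayerSite d i j L P)) t U) *
        (∏ t ∈ Finset.range (2 * (2 * P + 1)), SlabKernel.plaqWt (SlabKernel.wilsonWt ρ β)
            (rungAt (oddLayerSite d i j L P + tiltedUnit d i j (2 * P + 1) (2 * P + 1) L i))
            (loAt (oddLayerSite d i j L P + tiltedUnit d i j (2 * P + 1) (2 * P + 1) L i))
            (upAt (oddLayerSite d i j L P + tiltedUnit d i j (2 * P + 1) (2 * P + 1) L i)) t U) *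
        ∏ t ∈ Finset.range (2 * (2 * P + 1)), SlabKernel.plaqWt (SlabKernel.wilsonWt ρ β)
            (rungAt (0 : TiltedSite d i j (2 * P + 1) (2 * P + 1) L)) (loAt 0) (upAt 0) t U
      ∂(productHaar (TiltedSite d i j (2 * P + 1) (2 * P + 1) L) d G) =
    ∫ U, hRed ρ β F hij U * (SlabKernel.slabKernel (psiR P ρ β) (wLoR U)
        (wLoR (configMidReflect (tiltedUnit d i j (2 * P + 1) (2 * P + 1) L) i (tiltedAxisFlip d L (2 * P + 1) hij) U)) : ℂ) *
      (SlabKernel.slabKernel₂ (psiR P ρ β) (wUpR U)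
        (wUpR (configMidReflect (tiltedUnit d i j (2 * P + 1) (2 * P + 1) L) i (tiltedAxisFlip d L (2 * P + 1) hij) U)) : ℂ)
      ∂(productHaar (TiltedSite d i j (2 * P + 1) (2 * P + 1) L) d G) := by
  haveI : IsProbabilityMeasure (haarProbability G) := CompactGroup.isProbabilityMeasure_haarMeasure_top
  have hP : 1 ≤ P := one_le_P
  have hωc := SlabKernel.continuous_wilsonWt ρ hρ β
  have hωz := SlabKernel.wilsonWt_central ρ β
  have hωi := SlabKernel.wilsonWt_inv ρ hρ β
  have hψc : Continuous (psiR P ρ β) := SlabKernel.continuous_convPow hωc _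
  have hψz : ∀ g h, psiR P ρ β (h * g * h⁻¹) = psiR P ρ β g := SlabKernel.convPow_central hωz (2 * P + 1)
  have hψi : ∀ g, psiR P ρ β g⁻¹ = psiR P ρ β g := SlabKernel.convPow_inv hωz hωi (2 * P + 1)
  obtain ⟨C, -, hC⟩ := Literature.MathematicalPhysics.QuantumLattice.exists_forall_abs_le_of_continuous hωc
  obtain ⟨hhm, Ch, hhb⟩ := measurable_hRed_and_bound ρ hij hρ β hFm hFb
  obtain ⟨h0, hPv, hP1v⟩ := val_layers (d := d) (i := i) (j := j) (L := L) (P := P)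
  have hm : (1 : ℕ) ≤ 2 * P + 1 := by omega
  have hy₀v : (axisCoord d L (2 * P + 1) (0 : TiltedSite d i j (2 * P + 1) (2 * P + 1) L)).val = 0 ∨ (axisCoord d L (2 * P + 1) (0 : TiltedSite d i j (2 * P + 1) (2 * P + 1) L)).val = P ∨
      (axisCoord d L (2 * P + 1) (0 : TiltedSite d i j (2 * P + 1) (2 * P + 1) L)).val = P + 1 := Or.inl h0
  have hyPv : (axisCoord d L (2 * P + 1) (oddLayerSite d i j L P)).val = 0 ∨ (axisCoord d L (2 * P + 1) (oddLayerSite d i j L P)).val = P ∨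
      (axisCoord d L (2 * P + 1) (oddLayerSite d i j L P)).val = P + 1 := Or.inr (Or.inl hPv)
  have hyQv : (axisCoord d L (2 * P + 1) (oddLayerSite d i j L P + tiltedUnit d i j (2 * P + 1) (2 * P + 1) L i)).val = 0 ∨ (axisCoord d L (2 * P + 1) (oddLayerSite d i j L P + tiltedUnit d i j (2 * P + 1) (2 * P + 1) L i)).val = P ∨
      (axisCoord d L (2 * P + 1) (oddLayerSite d i j L P + tiltedUnit d i j (2 * P + 1) (2 * P + 1) L i)).val = P + 1 := Or.inr (Or.inr hP1v)
  have hP0 : (axisCoord d L (2 * P + 1) (oddLayerSite d i j L P)).val ≠ (axisCoord d L (2 * P + 1) (0 : TiltedSite d i j (2 * P + 1) (2 * P + 1) L)).val := by rw [hPv, h0]; omega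
  have hQ0 : (axisCoord d L (2 * P + 1) (oddLayerSite d i j L P + tiltedUnit d i j (2 * P + 1) (2 * P + 1) L i)).val ≠ (axisCoord d L (2 * P + 1) (0 : TiltedSite d i j (2 * P + 1) (2 * P + 1) L)).val := by rw [hP1v, h0]; omega
  have hQP : (axisCoord d L (2 * P + 1) (oddLayerSite d i j L P + tiltedUnit d i j (2 * P + 1) (2 * P + 1) L i)).val ≠ (axisCoord d L (2 * P + 1) (oddLayerSite d i j L P)).val := by rw [hP1v, hPv]; omega
  -- the annulus products as functions, their measurability, bounds and invariances
  set pr : TiltedSite d i j (2 * P + 1) (2 * P + 1) L → Config (TiltedSite d i j (2 * P + 1) (2 * P + 1) L) d G → ℂ :=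
    fun y U => ∏ t ∈ Finset.range (2 * (2 * P + 1)), SlabKernel.plaqWt (SlabKernel.wilsonWt ρ β) (rungAt y) (loAt y) (upAt y) t U
    with hpr
  have hprm : ∀ y, Measurable (pr y) := fun y => Finset.measurable_prod _ fun t _ =>
    (SlabKernel.continuous_plaqWt hωc (fun t => continuous_apply _) (fun t => continuous_apply _) t).measurable
  have hprb : ∀ y U, ‖pr y U‖ ≤ C ^ (2 * (2 * P + 1)) := fun y U => by
    rw [hpr, norm_prod]
    calc ∏ t ∈ Finset.range (2 * (2 * P + 1)), ‖SlabKernel.plaqWt (SlabKernel.wilsonWt ρ β) (rungAt y) (loAt y) (upAt y) t U‖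
        ≤ ∏ _t ∈ Finset.range (2 * (2 * P + 1)), C :=
          Finset.prod_le_prod (fun _ _ => norm_nonneg _) fun t _ => SlabKernel.norm_plaqWt_le hC t U
      _ = C ^ (2 * (2 * P + 1)) := by rw [Finset.prod_const, Finset.card_range]
  have hpru : ∀ y y' : TiltedSite d i j (2 * P + 1) (2 * P + 1) L,
      (axisCoord d L (2 * P + 1) y).val ≠ (axisCoord d L (2 * P + 1) y').val →
      ∀ s U z, pr y (update U (rungAt y' s) z) = pr y U := fun y y' hne s U z => by
    simp only [hpr]
    refine Finset.prod_congr rfl fun t _ => ?_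
    exact SlabKernel.plaqWt_update_of_ne (rungAt_ne_of_val_ne hij hne _ _) (rungAt_ne_of_val_ne hij hne _ _)
      (fun U z => loAt_update hij _ _ _ _ U z) (fun U z => upAt_update hij _ _ _ _ U z) U z
  have hC0 : 0 ≤ C ^ (2 * (2 * P + 1)) := pow_nonneg ((abs_nonneg _).trans (hC 1)) _
  have hCh0 : 0 ≤ Ch := (norm_nonneg _).trans (hhb (fun _ => 1))
  -- Step A: the lower annulus (through `0`), against `h₁ = h · pr yP · pr yQ`
  set h₁ : Config (TiltedSite d i j (2 * P + 1) (2 * P + 1) L) d G → ℂ := fun U =>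
    hRed ρ β F hij U * pr (oddLayerSite d i j L P) U * pr (oddLayerSite d i j L P + tiltedUnit d i j (2 * P + 1) (2 * P + 1) L i) U with hh₁
  have hA : ∀ U, hRed ρ β F hij U * (∏ t ∈ Finset.range (2 * (2 * P + 1)), SlabKernel.plaqWt (SlabKernel.wilsonWt ρ β) (rungAt (oddLayerSite d i j L P)) (loAt (oddLayerSite d i j L P)) (upAt (oddLayerSite d i j L P)) t U) *
      (∏ t ∈ Finset.range (2 * (2 * P + 1)), SlabKernel.plaqWt (SlabKernel.wilsonWt ρ β) (rungAt (oddLayerSite d i j L P + tiltedUnit d i j (2 * P + 1) (2 * P + 1) L i)) (loAt (oddLayerSite d i j L P + tiltedUnit d i j (2 * P + 1) (2 * P + 1) L i)) (upAt (oddLayerSite d i j L P + tiltedUnit d i j (2 * P + 1) (2 * P + 1) L i)) t U) *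
      ∏ t ∈ Finset.range (2 * (2 * P + 1)), SlabKernel.plaqWt (SlabKernel.wilsonWt ρ β) (rungAt (0 : TiltedSite d i j (2 * P + 1) (2 * P + 1) L)) (loAt (0 : TiltedSite d i j (2 * P + 1) (2 * P + 1) L)) (upAt (0 : TiltedSite d i j (2 * P + 1) (2 * P + 1) L)) t U =
      h₁ U * ∏ t ∈ Finset.range (2 * (2 * P + 1)), SlabKernel.plaqWt (SlabKernel.wilsonWt ρ β) (rungAt (0 : TiltedSite d i j (2 * P + 1) (2 * P + 1) L)) (loAt (0 : TiltedSite d i j (2 * P + 1) (2 * P + 1) L)) (upAt (0 : TiltedSite d i j (2 * P + 1) (2 * P + 1) L)) t U := fun U => rfl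
  simp_rw [hA]
  unfold productHaar
  rw [SlabKernel.integral_mul_annulus (r := rungAt (0 : TiltedSite d i j (2 * P + 1) (2 * P + 1) L)) (a := loAt (0 : TiltedSite d i j (2 * P + 1) (2 * P + 1) L)) (b := upAt (0 : TiltedSite d i j (2 * P + 1) (2 * P + 1) L))
    hωc hωz hm (by simpa using rungAt_add_two_mul hij (0 : TiltedSite d i j (2 * P + 1) (2 * P + 1) L) 0) (rungAt_inj hij (0 : TiltedSite d i j (2 * P + 1) (2 * P + 1) L))
    (fun t => continuous_apply _) (fun t => continuous_apply _) (fun t s U z => loAt_update hij _ _ t s U z)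
    (fun t s U z => upAt_update hij _ _ t s U z) (h := h₁) ((hhm.mul (hprm _)).mul (hprm _))
    (K := Ch * C ^ (2 * (2 * P + 1)) * C ^ (2 * (2 * P + 1))) (fun U => by
      rw [hh₁, norm_mul, norm_mul]
      exact mul_le_mul (mul_le_mul (hhb U) (hprb _ U) (norm_nonneg _) hCh0) (hprb _ U) (norm_nonneg _)
        (mul_nonneg hCh0 hC0))
    (fun s U z => by simp only [hh₁, hRed_update_rung ρ hij hd β hFo hy₀v s U z, hpru _ _ hP0, hpru _ _ hQ0])]
  -- Step B: the annulus `P|P+1` (through `y₀ = [P e_i]`), against `h₂ = h · k₀ · pr yQ`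
  have hkc : Continuous fun q : G × G => SlabKernel.slabKernel (psiR P ρ β) q.1 q.2 :=
    SlabKernel.continuous_uncurry_slabKernel hψc
  obtain ⟨Ck, hCk⟩ := (isCompact_univ (X := G × G)).exists_bound_of_continuousOn hkc.continuousOn
  have hCk' : ∀ a b : G, ‖(SlabKernel.slabKernel (psiR P ρ β) a b : ℂ)‖ ≤ Ck := fun a b => by
    rw [Complex.norm_real]; exact hCk (a, b) (Set.mem_univ _)
  have hCk0 : 0 ≤ Ck := (norm_nonneg _).trans (hCk' 1 1)
  set k₀ : Config (TiltedSite d i j (2 * P + 1) (2 * P + 1) L) d G → ℂ := fun U =>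
    (SlabKernel.slabKernel (psiR P ρ β) (SlabKernel.oprod (loAt (0 : TiltedSite d i j (2 * P + 1) (2 * P + 1) L)) (2 * (2 * P + 1)) U) (wLoR U) : ℂ) with hk₀
  have hlo : ∀ y : TiltedSite d i j (2 * P + 1) (2 * P + 1) L, Continuous (SlabKernel.oprod (loAt (G := G) y) (2 * (2 * P + 1))) :=
    fun y => SlabKernel.continuous_oprod (fun t => continuous_apply _) _
  have hup : ∀ y : TiltedSite d i j (2 * P + 1) (2 * P + 1) L, Continuous (SlabKernel.oprod (upAt (G := G) y) (2 * (2 * P + 1))) :=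
    fun y => SlabKernel.continuous_oprod (fun t => continuous_apply _) _
  have hk₀m : Measurable k₀ := (Complex.continuous_ofReal.comp (hkc.comp ((hlo _).prodMk (hup _)))).measurable
  have hk₀b : ∀ U, ‖k₀ U‖ ≤ Ck := fun U => hCk' _ _
  have hk₀u : ∀ (y' : TiltedSite d i j (2 * P + 1) (2 * P + 1) L) s U z, k₀ (update U (rungAt y' s) z) = k₀ U := fun y' s U z => by
    simp only [hk₀, wLoR, SlabKernel.oprod_update (fun t U z => loAt_update hij _ _ t s U z),
      SlabKernel.oprod_update (fun t U z => upAt_update hij _ _ t s U z)]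
  set h₂ : Config (TiltedSite d i j (2 * P + 1) (2 * P + 1) L) d G → ℂ := fun U => hRed ρ β F hij U * k₀ U * pr (oddLayerSite d i j L P + tiltedUnit d i j (2 * P + 1) (2 * P + 1) L i) U with hh₂
  have hB : ∀ U, h₁ U * (SlabKernel.slabKernel (SlabKernel.convPow (SlabKernel.wilsonWt ρ β) (2 * P + 1))
      (SlabKernel.oprod (loAt (0 : TiltedSite d i j (2 * P + 1) (2 * P + 1) L)) (2 * (2 * P + 1)) U) (SlabKernel.oprod (upAt (0 : TiltedSite d i j (2 * P + 1) (2 * P + 1) L)) (2 * (2 * P + 1)) U) : ℂ) =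
      h₂ U * ∏ t ∈ Finset.range (2 * (2 * P + 1)), SlabKernel.plaqWt (SlabKernel.wilsonWt ρ β) (rungAt (oddLayerSite d i j L P)) (loAt (oddLayerSite d i j L P)) (upAt (oddLayerSite d i j L P)) t U := fun U => by
    simp only [hh₁, hh₂, hk₀, hpr, wLoR, psiR]; ring
  simp_rw [hB]
  rw [SlabKernel.integral_mul_annulus (r := rungAt (oddLayerSite d i j L P)) (a := loAt (oddLayerSite d i j L P)) (b := upAt (oddLayerSite d i j L P)) hωc hωz hm
    (by simpa using rungAt_add_two_mul hij (oddLayerSite d i j L P) 0) (rungAt_inj hij _)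
    (fun t => continuous_apply _) (fun t => continuous_apply _) (fun t s U z => loAt_update hij _ _ t s U z)
    (fun t s U z => upAt_update hij _ _ t s U z) (h := h₂) ((hhm.mul hk₀m).mul (hprm _)) (K := Ch * Ck * C ^ (2 * (2 * P + 1)))
    (fun U => by
      rw [hh₂, norm_mul, norm_mul]
      exact mul_le_mul (mul_le_mul (hhb U) (hk₀b U) (norm_nonneg _) hCh0) (hprb _ U) (norm_nonneg _) (mul_nonneg hCh0 hCk0))
    (fun s U z => by simp only [hh₂, hRed_update_rung ρ hij hd β hFo hyPv s U z, hk₀u, hpru _ _ hQP])]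
  -- Step C: the annulus `P+1|P+2` (through `y₀ + e_i`), against `h₃ = h · k₀ · k_P`
  set kP : Config (TiltedSite d i j (2 * P + 1) (2 * P + 1) L) d G → ℂ := fun U =>
    (SlabKernel.slabKernel (psiR P ρ β) (wUpR U) (wMidR U) : ℂ) with hkP
  have hkPm : Measurable kP := (Complex.continuous_ofReal.comp (hkc.comp ((hlo _).prodMk (hup _)))).measurable
  have hkPb : ∀ U, ‖kP U‖ ≤ Ck := fun U => hCk' _ _
  have hkPu : ∀ (y' : TiltedSite d i j (2 * P + 1) (2 * P + 1) L) s U z, kP (update U (rungAt y' s) z) = kP U := fun y' s U z => by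
    simp only [hkP, wUpR, wMidR, SlabKernel.oprod_update (fun t U z => loAt_update hij _ _ t s U z),
      SlabKernel.oprod_update (fun t U z => upAt_update hij _ _ t s U z)]
  set h₃ : Config (TiltedSite d i j (2 * P + 1) (2 * P + 1) L) d G → ℂ := fun U => hRed ρ β F hij U * k₀ U * kP U with hh₃
  have hCstep : ∀ U, h₂ U * (SlabKernel.slabKernel (SlabKernel.convPow (SlabKernel.wilsonWt ρ β) (2 * P + 1))
      (SlabKernel.oprod (loAt (oddLayerSite d i j L P)) (2 * (2 * P + 1)) U) (SlabKernel.oprod (upAt (oddLayerSite d i j L P)) (2 * (2 * P + 1)) U) : ℂ) =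
      h₃ U * ∏ t ∈ Finset.range (2 * (2 * P + 1)), SlabKernel.plaqWt (SlabKernel.wilsonWt ρ β) (rungAt (oddLayerSite d i j L P + tiltedUnit d i j (2 * P + 1) (2 * P + 1) L i)) (loAt (oddLayerSite d i j L P + tiltedUnit d i j (2 * P + 1) (2 * P + 1) L i)) (upAt (oddLayerSite d i j L P + tiltedUnit d i j (2 * P + 1) (2 * P + 1) L i)) t U := fun U => by
    simp only [hh₂, hh₃, hkP, hpr, wUpR, wMidR, psiR]; ring
  simp_rw [hCstep]
  rw [SlabKernel.integral_mul_annulus (r := rungAt (oddLayerSite d i j L P + tiltedUnit d i j (2 * P + 1) (2 * P + 1) L i))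
    (a := loAt (oddLayerSite d i j L P + tiltedUnit d i j (2 * P + 1) (2 * P + 1) L i)) (b := upAt (oddLayerSite d i j L P + tiltedUnit d i j (2 * P + 1) (2 * P + 1) L i)) hωc hωz hm
    (by simpa using rungAt_add_two_mul hij (oddLayerSite d i j L P + tiltedUnit d i j (2 * P + 1) (2 * P + 1) L i) 0) (rungAt_inj hij _)
    (fun t => continuous_apply _) (fun t => continuous_apply _) (fun t s U z => loAt_update hij _ _ t s U z)
    (fun t s U z => upAt_update hij _ _ t s U z) (h := h₃) ((hhm.mul hk₀m).mul hkPm) (K := Ch * Ck * Ck)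
    (fun U => by
      rw [hh₃, norm_mul, norm_mul]
      exact mul_le_mul (mul_le_mul (hhb U) (hk₀b U) (norm_nonneg _) hCh0) (hkPb U) (norm_nonneg _) (mul_nonneg hCh0 hCk0))
    (fun s U z => by simp only [hh₃, hRed_update_rung ρ hij hd β hFo hyQv s U z, hk₀u, hkPu])]
  -- Step D: one letter of the free layer, against `g = h · k₀`
  have hfold : SlabKernel.convPow (SlabKernel.wilsonWt ρ β) (2 * P + 1) = psiR P ρ β := rfl
  set g₄ : Config (TiltedSite d i j (2 * P + 1) (2 * P + 1) L) d G → ℂ := fun U => hRed ρ β F hij U * k₀ U with hg₄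
  set Φ₄ : Config (TiltedSite d i j (2 * P + 1) (2 * P + 1) L) d G → ℂ := fun U =>
    (SlabKernel.slabKernel (psiR P ρ β) (wUpR U) (wMidR U) : ℂ) * (SlabKernel.slabKernel (psiR P ρ β) (wMidR U) (wTopR U) : ℂ)
    with hΦ₄
  have hDstep : ∀ U, h₃ U * (SlabKernel.slabKernel (SlabKernel.convPow (SlabKernel.wilsonWt ρ β) (2 * P + 1))
      (SlabKernel.oprod (loAt (oddLayerSite d i j L P + tiltedUnit d i j (2 * P + 1) (2 * P + 1) L i)) (2 * (2 * P + 1)) U)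
      (SlabKernel.oprod (upAt (oddLayerSite d i j L P + tiltedUnit d i j (2 * P + 1) (2 * P + 1) L i)) (2 * (2 * P + 1)) U) : ℂ) =
      g₄ U * Φ₄ U := fun U => by
    simp only [hh₃, hg₄, hΦ₄, hkP, hfold, oprod_loAt_oddLayerSite_add, wMidR, wTopR]; ring
  simp_rw [hDstep]
  obtain ⟨-, hwUp, hwMid, hwTop⟩ := continuous_wordsR (L := L) (P := P) (i := i) (j := j) (d := d) (G := G)
  have hΦ₄m : Measurable Φ₄ :=
    ((Complex.continuous_ofReal.comp (hkc.comp (hwUp.prodMk hwMid))).mul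
      (Complex.continuous_ofReal.comp (hkc.comp (hwMid.prodMk hwTop)))).measurable
  have hΦ₄b : ∀ U, ‖Φ₄ U‖ ≤ Ck * Ck := fun U => by
    rw [hΦ₄, norm_mul]; exact mul_le_mul (hCk' _ _) (hCk' _ _) (norm_nonneg _) hCk0
  have hg₄m : Measurable g₄ := hhm.mul hk₀m
  have hg₄b : ∀ U, ‖g₄ U‖ ≤ Ch * Ck := fun U => by
    rw [hg₄, norm_mul]; exact mul_le_mul (hhb U) (hk₀b U) (norm_nonneg _) hCh0
  have hg₄u : ∀ U z, g₄ (update U ((oddLayerSite d i j L P + tiltedUnit d i j (2 * P + 1) (2 * P + 1) L i), j) z) = g₄ U := fun U z => by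
    simp only [hg₄, hRed_update_freeLetter ρ hij hd β hFo hP1v U z, hk₀, wLoR]
    congr 3
    · unfold SlabKernel.oprod
      congr 1
      refine List.map_congr_left fun t _ => ?_
      unfold loAt
      rw [update_of_ne]
      intro he
      have h1 := congrArg (fun l => (axisCoord d L (2 * P + 1) l.1).val) he
      simp only [axisCoord_cyc hij, hP1v, h0] at h1
      omega
    · unfold SlabKernel.oprod
      congr 1
      refine List.map_congr_left fun t _ => ?_
      unfold upAt
      rw [update_of_ne]
      intro he
      have h1 := congrArg (fun l => (axisCoord d L (2 * P + 1) l.1).val) he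
      simp only at h1
      rw [hP1v, axisCoord_add_tiltedUnit, if_pos rfl, axisCoord_cyc hij, map_zero, zero_add] at h1
      have hM1 : 2 * P + 1 ≠ 1 := by omega
      rw [ZMod.val_one'' hM1] at h1
      omega
  rw [SlabKernel.integral_mul_eq_integral_mul_update ((oddLayerSite d i j L P + tiltedUnit d i j (2 * P + 1) (2 * P + 1) L i), j) hg₄m hΦ₄m hg₄b hΦ₄b hg₄u]
  have hinnerD : ∀ U, ∫ z, Φ₄ (update U ((oddLayerSite d i j L P + tiltedUnit d i j (2 * P + 1) (2 * P + 1) L i), j) z) ∂haarProbability G =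
      (SlabKernel.slabKernel₂ (psiR P ρ β) (wUpR U) (wTopR U) : ℂ) := fun U => by
    have hUp : ∀ z, wUpR (update U ((oddLayerSite d i j L P + tiltedUnit d i j (2 * P + 1) (2 * P + 1) L i), j) z) = wUpR U := fun z => by
      unfold wUpR SlabKernel.oprod
      congr 1
      refine List.map_congr_left fun t _ => ?_
      unfold loAt
      rw [update_of_ne]
      intro he
      have h1 := congrArg (fun l => (axisCoord d L (2 * P + 1) l.1).val) he
      simp only [axisCoord_cyc hij, hP1v, hPv] at h1
      omega
    have hTop : ∀ z, wTopR (update U ((oddLayerSite d i j L P + tiltedUnit d i j (2 * P + 1) (2 * P + 1) L i), j) z) = wTopR U := fun z => by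
      unfold wTopR SlabKernel.oprod
      congr 1
      refine List.map_congr_left fun t _ => ?_
      unfold upAt
      rw [update_of_ne]
      intro he
      have h1 := congrArg (fun l => axisCoord d L (2 * P + 1) l.1) he
      simp only at h1
      rw [← axisCoord_cyc hij (oddLayerSite d i j L P + tiltedUnit d i j (2 * P + 1) (2 * P + 1) L i) t] at h1
      exact axisCoord_add_self_ne _ h1
    have e : ∀ z, Φ₄ (update U ((oddLayerSite d i j L P + tiltedUnit d i j (2 * P + 1) (2 * P + 1) L i), j) z) = ((SlabKernel.slabKernel (psiR P ρ β) (wUpR U)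
        (1 * z * SlabKernel.oprod (fun t => upAt (oddLayerSite d i j L P) (1 + t)) (2 * (2 * P + 1) - 1) U) *
        SlabKernel.slabKernel (psiR P ρ β)
          (1 * z * SlabKernel.oprod (fun t => upAt (oddLayerSite d i j L P) (1 + t)) (2 * (2 * P + 1) - 1) U) (wTopR U) : ℝ) : ℂ) :=
      fun z => by
        simp only [hΦ₄, hUp z, hTop z, wMidR_update hij U z, Complex.ofReal_mul]
    simp_rw [e]
    rw [integral_complex_ofReal, SlabKernel.integral_slabKernel_mul_slabKernel hψc hψz hψi]
  simp_rw [hinnerD]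
  -- Step E: the lower annulus is exact, the upper words are conjugate
  refine integral_congr_ae (ae_of_all _ fun U => ?_)
  simp only [hg₄, hk₀, wLoR, wUpR, wTopR]
  rw [← oprod_upAt_zero_configMidReflect_odd hij (2 * (2 * P + 1)) U, SlabKernel.slabKernel_symm hψc hψz hψi,
    oprod_upAt_succ_eq_conj hij U, SlabKernel.slabKernel₂_conj_right hψz, mul_assoc]

end TwoDim

end TiltedRP

end Summit.QuantumFields.GaugeBoot

end
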